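import Literature.Geometry.Lorentzian.BogovskiiVectorL2Bound
import HarnessLib

/-!
# `L¹ → L¹` and `L^∞ → L^∞` bounds for the vector Bogovskiĭ-type operator `SV_η` on densities in a ball

(trunk G08 = T-LORENTZ; family `gr`; namespace `Literature.Geometry.Lorentzian.MaoOhTao`.)

The vector building block `(SV_η g)^a(x) = ∫ w_y (x − y)_a/|x − y|³ g(y) dy` of Mao–Oh–Tao's Lemma 2.3
(arXiv:2308.13031; Bogovskiĭ's operator for the divergence equation, `BogovskiiScalarDivergence.lean`) has a kernel with
the translation-invariant majorant `|V^a_η(x, y)| ≤ W 𝟙_{|x − y| ≤ R + ρ}/|x − y|²` for `|y| ≤ ρ`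
(`abs_classicalVKernel_le`), which is integrable on `ℝ³`.  `BogovskiiVectorL2Bound.lean` turns this into the `L²` bound by
Schur's test; this file records the two endpoint cases of the same majorisation (row and column sums, i.e. Young's
inequality at `p = 1, ∞`):

* `lintegral_enorm_bogovskiiSV_le` — pointwise: `‖(SV_η g)^a(x)‖ₑ ≤ ∫⁻ k(x − y) ‖g y‖ₑ dy` with the majorant `k`;
* `exists_l1Const_bogovskiiSV` — **`L¹ → L¹`**: `∫⁻ ‖(SV_η g)^a‖ₑ ≤ C ∫⁻ ‖g‖ₑ`, `C = ∫ k < ∞`, for continuous `g`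
  supported in `B̄_ρ`;
* `exists_supConst_bogovskiiSV` — **`L^∞ → L^∞`**: `|(SV_η g)^a(x)| ≤ C M` whenever `|g| ≤ M`.

Everything is proved; no definitions, no named facts.  (Galdi, III.3, (III.3.20): the classical estimates of the
Bogovskiĭ operator; here only the orders `0` needed for the size bookkeeping of glued correctors.)

## References

* Y. Mao, S.-J. Oh, T. Tao, arXiv:2308.13031 (2023), Lemma 2.3 (T3), pp. 8–9 (key `MaoOhTao2023`).
* G. P. Galdi, *An Introduction to the Mathematical Theory of the Navier–Stokes Equations. Steady-State Problems*,
  2nd ed., Springer (2011), §III.3 (key `Galdi2011`).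
-/

noncomputable section

open scoped RealInnerProductSpace Topology ENNReal
open Filter MeasureTheory Set Metric Function

namespace Literature.Geometry.Lorentzian

namespace MaoOhTao

variable {η : E3 → ℝ} {R : ℝ}

/-- The Schur majorant `z ↦ W 𝟙_{|z| ≤ D}/|z|²` (as an `ℝ≥0∞`-valued function) is measurable. [folklore] -/
theorem measurable_vmajorant (W D : ℝ) :
    Measurable fun z : E3 ↦ ENNReal.ofReal ((closedBall (0 : E3) D).indicator (fun z ↦ W * (‖z‖ ^ 2)⁻¹) z) :=
  ((measurable_const.mul ((measurable_norm.pow_const 2).inv)).indicator measurableSet_closedBall).ennreal_ofReal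

/-- **Pointwise majorisation**: for continuous `g` supported in `B̄_ρ` and the weight bound `W` on `B̄_ρ`,
`‖(SV_η g)^a(x)‖ₑ ≤ ∫⁻ k(x − y) ‖g(y)‖ₑ dy` with `k = max(W,0) 𝟙_{|z| ≤ R+ρ}/|z|²`. [folklore] -/
theorem lintegral_enorm_bogovskiiSV_le (hR : ∀ z : E3, R < ‖z‖ → η z = 0) {W ρ : ℝ}
    (hW : ∀ y : E3, ‖y‖ ≤ ρ → ∀ (r : ℝ) (α : E3), ‖α‖ = 1 → |bogovskiiWeight η y r α| ≤ W)
    {g : E3 → ℝ} (hgρ : ∀ y, g y ≠ 0 → ‖y‖ ≤ ρ) (a : Fin 3) (x : E3) :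
    ‖bogovskiiSV η g a x‖ₑ ≤ ∫⁻ y : E3, ENNReal.ofReal ((closedBall (0 : E3) (R + ρ)).indicator
      (fun z ↦ max W 0 * (‖z‖ ^ 2)⁻¹) (x - y)) * ‖g y‖ₑ := by
  rw [bogovskiiSV_apply]
  refine (enorm_integral_le_lintegral_enorm _).trans (lintegral_mono fun y ↦ ?_)
  rw [bogovskiiV_eq_classical η y (x - y) a, enorm_mul]
  by_cases hgy : g y = 0
  · simp [hgy]
  · gcongr
    rw [Real.enorm_eq_ofReal_abs]
    exact ENNReal.ofReal_le_ofReal (abs_classicalVKernel_le hR (le_max_right _ _)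
      (fun y hy r α hα ↦ (hW y hy r α hα).trans (le_max_left _ _)) (hgρ y hgy) x a)

/-- **`L¹ → L¹` bound for `SV_η` on densities supported in a ball**: there is `C < ∞` (the integral of the majorant) with
`∫⁻ ‖(SV_η g)^a‖ₑ ≤ C ∫⁻ ‖g‖ₑ` for every continuous `g` supported in `B̄_ρ` (Tonelli on the majorisation).
[cite: Galdi2011, §III.3] -/
theorem exists_l1Const_bogovskiiSV (hη : Continuous η) (hR : ∀ z : E3, R < ‖z‖ → η z = 0) (ρ : ℝ) :
    ∃ C : ℝ≥0∞, C < ⊤ ∧ ∀ (g : E3 → ℝ), Continuous g → (∀ y, g y ≠ 0 → ‖y‖ ≤ ρ) → ∀ a : Fin 3,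
      ∫⁻ x : E3, ‖bogovskiiSV η g a x‖ₑ ≤ C * ∫⁻ y : E3, ‖g y‖ₑ := by
  obtain ⟨W, hW⟩ := exists_abs_bogovskiiWeight_le_of_norm_le hη hR ρ
  set k : E3 → ℝ≥0∞ := fun z ↦ ENNReal.ofReal ((closedBall (0 : E3) (R + ρ)).indicator
    (fun z ↦ max W 0 * (‖z‖ ^ 2)⁻¹) z) with hk
  have hkm : Measurable k := measurable_vmajorant _ _
  refine ⟨∫⁻ z : E3, k z, lintegral_vmajorant_lt_top _ _, fun g hg hgρ a ↦ ?_⟩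
  have hgm : Measurable fun y : E3 ↦ ‖g y‖ₑ := hg.measurable.enorm
  calc ∫⁻ x : E3, ‖bogovskiiSV η g a x‖ₑ ≤ ∫⁻ x : E3, ∫⁻ y : E3, k (x - y) * ‖g y‖ₑ :=
        lintegral_mono fun x ↦ lintegral_enorm_bogovskiiSV_le hR hW hgρ a x
    _ = ∫⁻ y : E3, ∫⁻ x : E3, k (x - y) * ‖g y‖ₑ :=
        lintegral_lintegral_swap (((hkm.comp (measurable_fst.sub measurable_snd)).mul
          (hgm.comp measurable_snd)).aemeasurable)
    _ = ∫⁻ y : E3, (∫⁻ z : E3, k z) * ‖g y‖ₑ := by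
        refine lintegral_congr fun y ↦ ?_
        have hm : Measurable fun x : E3 ↦ k (x - y) := hkm.comp (measurable_id.sub measurable_const)
        rw [lintegral_mul_const _ hm, lintegral_sub_right_eq_self k y]
    _ = (∫⁻ z : E3, k z) * ∫⁻ y : E3, ‖g y‖ₑ := lintegral_const_mul _ hgm

/-- **`L^∞ → L^∞` bound for `SV_η` on densities supported in a ball**: there is `C` (the integral of the majorant) with
`|(SV_η g)^a(x)| ≤ C M` for every `x`, every continuous `g` supported in `B̄_ρ` and every bound `|g| ≤ M`.
[cite: Galdi2011, §III.3] -/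
theorem exists_supConst_bogovskiiSV (hη : Continuous η) (hR : ∀ z : E3, R < ‖z‖ → η z = 0) (ρ : ℝ) :
    ∃ C : ℝ, 0 ≤ C ∧ ∀ (g : E3 → ℝ), Continuous g → (∀ y, g y ≠ 0 → ‖y‖ ≤ ρ) → ∀ M : ℝ, (∀ y, |g y| ≤ M) →
      ∀ (a : Fin 3) (x : E3), |bogovskiiSV η g a x| ≤ C * M := by
  obtain ⟨W, hW⟩ := exists_abs_bogovskiiWeight_le_of_norm_le hη hR ρ
  set k : E3 → ℝ≥0∞ := fun z ↦ ENNReal.ofReal ((closedBall (0 : E3) (R + ρ)).indicator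
    (fun z ↦ max W 0 * (‖z‖ ^ 2)⁻¹) z) with hk
  have hkm : Measurable k := measurable_vmajorant _ _
  have hCk : (∫⁻ z : E3, k z) < ⊤ := lintegral_vmajorant_lt_top _ _
  refine ⟨(∫⁻ z : E3, k z).toReal, ENNReal.toReal_nonneg, fun g hg hgρ M hM a x ↦ ?_⟩
  have hM0 : 0 ≤ M := (abs_nonneg _).trans (hM x)
  have h1 : ‖bogovskiiSV η g a x‖ₑ ≤ (∫⁻ z : E3, k z) * ENNReal.ofReal M := by
    calc ‖bogovskiiSV η g a x‖ₑ ≤ ∫⁻ y : E3, k (x - y) * ‖g y‖ₑ := lintegral_enorm_bogovskiiSV_le hR hW hgρ a x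
      _ ≤ ∫⁻ y : E3, k (x - y) * ENNReal.ofReal M := by
          refine lintegral_mono fun y ↦ ?_
          gcongr
          rw [Real.enorm_eq_ofReal_abs]
          exact ENNReal.ofReal_le_ofReal (hM y)
      _ = (∫⁻ z : E3, k z) * ENNReal.ofReal M := by
          have hm : Measurable fun y : E3 ↦ k (x - y) := hkm.comp (measurable_const.sub measurable_id)
          rw [lintegral_mul_const _ hm, lintegral_sub_left_eq_self k x]
  rw [Real.enorm_eq_ofReal_abs, ENNReal.ofReal_le_iff_le_toReal (ENNReal.mul_ne_top hCk.ne ENNReal.ofReal_ne_top)]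
    at h1
  rwa [ENNReal.toReal_mul, ENNReal.toReal_ofReal hM0] at h1

end MaoOhTao

end Literature.Geometry.Lorentzian

end
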